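import Summits.HodgeConjecture.CorCM.IrreducibleOddWeightsShadowIdealsCommutative
import Summits.HodgeConjecture.CorCM.IrreducibleOddWeightsOrbitBalanceCMFields
import HarnessLib

/-!
# Shadow ideals, V: two CM fields over a common GALOIS pivot `M` — `Hg(A₀ × A₁) = Hg(A₀) × Hg(A₁)` iff the Hecke
# translates of the two shadows span subspaces of `ℚ^{Hom(M, ℂ)}` meeting in `0`; for `M` ABELIAN iff the shadows are
# uncorrelated in every relative position

COR-CM (cell `pub-hodgecm2`, binder seat `b16` gen 63, count-neutral claim SHADOW IDEALS, file S5 — CM fields and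
realisations; theorems only, no definition, no named fact, no `sorry`).  NEW as stated, hence under `Summits/`.  HONEST
FRAMING: unconditional statements about `dim MT(A₀ × A₁)` and about which Hodge classes on `A₀^a × A₁^b` are sums of
products; no Hodge class is claimed algebraic; `HC_CM` is neither used nor asserted.

SETTING.  A two-slot family `{i₀, i₁}` of CM fields `K_i` with types `Φ_i` and realisations `A_i ⊨ (K_i; Φ_i)`; a number
field `M`, GALOIS over `ℚ`, embedded in both (`j₀ : M → K_{i₀}`, `j₁ : M → K_{i₁}`), `z₀ : M → ℂ`; the SHADOWS
`w_κ(z) = Σ_{t|_M = z} u_1(Φ_{i_κ})(t) = 2·#{t ∈ Φ_{i_κ} | t ∘ j_κ = z} − [K_{i_κ} : M]` (`z ∈ Hom(M, ℂ)`) and their HECKE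
TRANSLATES `w_κ(· ∘ δ)`, `δ ∈ Gal(M/ℚ)`.  No irreducibility, no equidistribution, no nondegeneracy hypothesis.

* §1 The pivot hypotheses of the abstract files hold for `Aut(ℂ)` acting on complex embeddings: restriction to `M` is an
  equivariant SURJECTION (`comp_surjective`), `Aut(ℂ/z₀M)` is transitive on its fibres (gen 62
  `exists_smul_eq_of_comp_eq`) and, when the Galois closures `L_{i₀}`, `L_{i₁}` meet inside `z₀(M)`, lies in the subgroup
  generated by `Aut(ℂ/L_{i₀}) ∪ Aut(ℂ/L_{i₁})` (`mem_closure_fixing_of_normalClosure_inf_le`, gluing lemma); the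
  pre-compositions `z ↦ z ∘ δ` commute with `Aut(ℂ)`, are injective and transitive.
* §2 **`cmFamilyRank_add_card_lt_of_span_precomp_shadow_inf_ne_bot`** (NO hypothesis on the closures): a common
  non-zero Hecke combination `Σ a_δ w₀(·∘δ) = Σ b_δ w₁(·∘δ) ≠ 0` forces `dim MT(A₀ × A₁) − 1 < Σ_κ (dim MT(A_κ) − 1)`.
  **`cmFamilyRank_add_card_eq_pair_iff_span_precomp_shadow_inf_eq_bot`** — THE CRITERION: if `L_{i₀} ∩ L_{i₁} ⊆ z₀(M)`,
  then `Hg(A₀ × A₁) = Hg(A₀) × Hg(A₁)` **iff `span{w₀(·∘δ)} ∩ span{w₁(·∘δ)} = 0`** (the right ideals of `ℚ[Gal(M/ℚ)]`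
  generated by the shadows meet in `0`).  SPECIAL CASES BY NAME: gen 62 O7 (`M = K_{i₁}`, `Φ_{i₁}` nondegenerate: the
  translates of `u₁` span `Anti(M) ∋ w₀`), O10 (`Anti(M)` irreducible), O5/O8 (`M = k`), gen 49 PARALLEL SHADOWS
  (`w₀ = q·w₁`); none of their hypotheses is needed here.
* §3 `M` ABELIAN: **`cmFamilyRank_add_card_eq_pair_iff_forall_sum_shadow_mul_eq_zero`** — `Hg(A₀ × A₁) = Hg(A₀) × Hg(A₁)`
  **iff `Σ_z w₀(z)·w₁(z ∘ δ) = 0` for every `δ ∈ Gal(M/ℚ)`** (finitely many integer equalities; in characters: no odd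
  character `χ` of `Gal(M/ℚ)` with `χ(w₀) ≠ 0 ≠ χ(w₁)` — Kubota's Lemma 2 for two DIFFERENT fields over a common abelian
  subfield); unconditional half `cmFamilyRank_add_card_lt_of_sum_shadow_mul_ne_zero`.
* §4 Realisations: **`forall_hodgeClassesProductSpan_pair_iff_span_precomp_shadow_inf_eq_bot`**,
  **`forall_hodgeClassesProductSpan_pair_iff_forall_sum_shadow_mul_eq_zero`** — every Hodge class on every
  `A₀^a × A₁^b` (disjoint slot maps) is a sum of exterior products iff the criterion holds; otherwise a MIXED exceptional
  class (`exists_not_hodgeClassesProductSpan_pair_of_…`).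

## References

* [Kubota1965] T. Kubota, *On the field extension by complex multiplication*, Trans. AMS 118 (1965), §2 Lemma 2, §4.
* [Gordon1999HodgeAVSurvey] B. B. Gordon, *A survey of the Hodge conjecture for abelian varieties*, §3 Theorem (proof),
  7.5–7.7, 9.4.1–9.4.3.
* [MoonenZarhin1999LowDim] B. Moonen, Yu. Zarhin, Math. Ann. 315 (1999), Thm. (0.1) (a), §3 (3.1).
* [Deligne1982HodgeCycles] P. Deligne, *Hodge cycles on abelian varieties*, LNM 900 (1982), I Ex. 3.7, §4.
* [Lang2002] S. Lang, *Algebra*, VI §1 Thm. 1.14, V §2 Thm. 2.8.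
* [Shimura1998] G. Shimura, *Abelian Varieties with Complex Multiplication and Modular Functions*, §8.1, §18.2.
-/

set_option autoImplicit false

noncomputable section

open scoped BigOperators Classical

open CategoryTheory CategoryTheory.Limits NumberField Module IntermediateField

namespace Summit.HodgeConjecture.CorCM

open Literature.NumberTheory.ComplexMultiplication
open Literature.AlgebraicGeometry.Motives (AbelianVariety CMType)
open Literature.AlgebraicGeometry.Motives.AbelianVariety
open Literature.AlgebraicGeometry.HodgeTheory
open Literature.AlgebraicGeometry.ComplexMultiplication (IsCMTypeRealisation)
open Literature.AlgebraicGeometry.Pohlmann1968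

/-! ### §1 The pivot hypotheses for complex embeddings -/

section Pivot

variable {M : Type} [Field M] [NumberField M] {L : Type} [Field L] [NumberField L]

/-- **Restriction of complex embeddings to a subfield is surjective** (transport any extension by `Aut(ℂ)`, which is
transitive on `Hom(M, ℂ)`). [cite: Shimura1998, §8.1] [cite: Lang2002, V §2 Thm. 2.8] -/
theorem comp_surjective (j : M →+* L) : Function.Surjective fun t : L →+* ℂ => t.comp j := by
  intro z
  obtain ⟨t₀⟩ : Nonempty (L →+* ℂ) := inferInstance
  haveI := isPretransitive_ringEquiv_complex (K := M)
  obtain ⟨g, hg⟩ := MulAction.exists_smul_eq (ℂ ≃+* ℂ) (t₀.comp j) z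
  exact ⟨g • t₀, by rw [← hg]; exact RingHom.ext fun _ => rfl⟩

/-- Pre-composition by an automorphism of `M` is injective on `Hom(M, ℂ)`. [folklore] -/
theorem comp_algEquiv_injective (δ : M ≃ₐ[ℚ] M) :
    Function.Injective fun z : M →+* ℂ => z.comp (δ : M →+* M) := by
  intro z z' h
  refine RingHom.ext fun m => ?_
  have h1 := RingHom.congr_fun h (δ.symm m)
  change z (δ (δ.symm m)) = z' (δ (δ.symm m)) at h1
  rwa [AlgEquiv.apply_symm_apply] at h1

/-- `Gal(M/ℚ)` moves every complex embedding of the normal field `M` to the base one by pre-composition.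
[cite: Shimura1998, §8.1] -/
theorem exists_comp_algEquiv_eq [Normal ℚ M] (z₀ z : M →+* ℂ) : ∃ δ : M ≃ₐ[ℚ] M, z.comp (δ : M →+* M) = z₀ := by
  obtain ⟨γ, hγ⟩ := exists_algEquiv_comp_eq z z₀
  exact ⟨γ, RingHom.ext fun x => hγ x⟩

variable {I : Type} {K : I → Type} [∀ i, Field (K i)] [∀ i, NumberField (K i)]

omit [NumberField M] in
/-- **The gluing lemma, pointwise-stabiliser form.**  If the Galois closures `L_{i₀}`, `L_{i₁}` meet inside `z₀(M)`,
every automorphism of `ℂ` fixing `z₀(M)` pointwise is a product `τ · (τ⁻¹ g)` with `τ` fixing every embedding of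
`K_{i₁}` and `τ⁻¹ g` fixing every embedding of `K_{i₀}`. [cite: Lang2002, VI §1 Thm. 1.14 and V §2 Thm. 2.8] -/
theorem mem_closure_fixing_of_normalClosure_inf_le {i₀ i₁ : I} (z₀ : M →+* ℂ)
    (hmeet : ∀ z : ℂ, z ∈ normalClosure ℚ (K i₀) ℂ → z ∈ normalClosure ℚ (K i₁) ℂ → z ∈ Set.range z₀)
    {g : ℂ ≃+* ℂ} (hg : ∀ m : M, g (z₀ m) = z₀ m) :
    g ∈ Subgroup.closure ({s : ℂ ≃+* ℂ | ∀ x : K i₀ →+* ℂ, s • x = x} ∪ {s : ℂ ≃+* ℂ | ∀ x : K i₁ →+* ℂ, s • x = x}) := by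
  haveI : ∀ l : I, @Normal ℚ ↥(normalClosure ℚ (K l) ℂ) _ _ (IntermediateField.algebra' _) :=
    normal_normalClosure_complex
  obtain ⟨τ, hA, hB⟩ := exists_ringEquiv_apply_eq_of_normal (A := normalClosure ℚ (K i₀) ℂ)
    (B := normalClosure ℚ (K i₁) ℂ) g (fun x h₀ h₁ => by
      obtain ⟨m, rfl⟩ := hmeet x h₀ h₁
      exact hg m)
  have hτ : τ ∈ ({s : ℂ ≃+* ℂ | ∀ x : K i₀ →+* ℂ, s • x = x} ∪ {s : ℂ ≃+* ℂ | ∀ x : K i₁ →+* ℂ, s • x = x}) :=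
    Or.inr fun x => RingHom.ext fun a => by
      rw [ringEquiv_smul_apply]
      exact hB _ (apply_mem_normalClosure i₁ x a)
  have hτg : τ⁻¹ * g ∈ ({s : ℂ ≃+* ℂ | ∀ x : K i₀ →+* ℂ, s • x = x} ∪ {s : ℂ ≃+* ℂ | ∀ x : K i₁ →+* ℂ, s • x = x}) :=
    Or.inl fun x => RingHom.ext fun a => by
      rw [ringEquiv_smul_apply]
      change τ.symm (g (x a)) = x a
      rw [RingEquiv.symm_apply_eq]
      exact (hA _ (apply_mem_normalClosure i₀ x a)).symm
  rw [show g = τ * (τ⁻¹ * g) by group]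
  exact Subgroup.mul_mem _ (Subgroup.subset_closure hτ) (Subgroup.subset_closure hτg)

end Pivot

/-! ### §2 The Hecke criterion for two CM fields over a common Galois pivot -/

section Rank

variable {I : Type} [Fintype I] {K : I → Type} [∀ i, Field (K i)] [∀ i, NumberField (K i)] [∀ i, IsCMField (K i)]
  {M : Type} [Field M] [NumberField M]

/-- **A COMMON NON-ZERO HECKE COMBINATION OF THE SHADOWS OBSTRUCTS `Hg(A₀ × A₁) = Hg(A₀) × Hg(A₁)`** (no hypothesis on
the Galois closures; `M` any number field received by both CM fields): if the Hecke translates `w₀(·∘δ)`, `w₁(·∘δ)`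
(`δ ∈ Aut(M)`) of the two shadows span subspaces of `ℚ^{Hom(M,ℂ)}` with a non-zero common element, then
`cmFamilyRank Φ + |I| < Σ_i cmTypeRank Φ_i + 1`. [cite: Gordon1999HodgeAVSurvey, §3 Theorem (proof) and 7.5]
[cite: Kubota1965, §4] -/
theorem cmFamilyRank_add_card_lt_of_span_precomp_shadow_inf_ne_bot {i₀ i₁ : I} (h01 : i₀ ≠ i₁)
    (Φ : ∀ i, CMType (K i)) (j₀ : M →+* K i₀) (j₁ : M →+* K i₁)
    (hne : Submodule.span ℚ (Set.range fun δ : M ≃ₐ[ℚ] M => fun z : M →+* ℂ =>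
        ∑ t ∈ Finset.univ.filter (fun t : K i₀ →+* ℂ => t.comp j₀ = z.comp (δ : M →+* M)),
          antiVec (Φ i₀).1 (1 : ℂ ≃+* ℂ) t) ⊓
      Submodule.span ℚ (Set.range fun δ : M ≃ₐ[ℚ] M => fun z : M →+* ℂ =>
        ∑ t ∈ Finset.univ.filter (fun t : K i₁ →+* ℂ => t.comp j₁ = z.comp (δ : M →+* M)),
          antiVec (Φ i₁).1 (1 : ℂ ≃+* ℂ) t) ≠ ⊥) :
    CMAlgebra.cmFamilyRank Φ + Fintype.card I < (∑ i, cmTypeRank (Φ i)) + 1 := by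
  haveI : Nonempty I := ⟨i₀⟩
  haveI : ∀ i, Nonempty (K i →+* ℂ) := fun i => inferInstance
  exact IrrOdd.typeRank_sigmaType_add_card_lt_of_span_precomp_inf_ne_bot (G := ℂ ≃+* ℂ) (E := fun i => K i →+* ℂ)
    (Φ := fun i => (Φ i).1) (fun i => isCMTypeWith_conj (Φ i)) h01 (fun t : K i₀ →+* ℂ => t.comp j₀)
    (fun t : K i₁ →+* ℂ => t.comp j₁) (fun _ _ => RingHom.ext fun _ => rfl) (fun _ _ => RingHom.ext fun _ => rfl)
    (fun (δ : M ≃ₐ[ℚ] M) (z : M →+* ℂ) => z.comp (δ : M →+* M)) (fun _ _ _ => RingHom.ext fun _ => rfl) hne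

/-- **THE HECKE CRITERION FOR TWO CM FIELDS OVER A COMMON GALOIS PIVOT.**  Two-slot family `{i₀, i₁}`; `M` Galois over
`ℚ` with `j_κ : M → K_{i_κ}`, `z₀ : M → ℂ`, and the Galois closures meeting inside `z₀(M)`.  Then
`Hg(A₀ × A₁) = Hg(A₀) × Hg(A₁)` (`cmFamilyRank Φ + 2 = cmTypeRank Φ₀ + cmTypeRank Φ₁ + 1`) **iff the Hecke translates
`w₀(·∘δ)`, `w₁(·∘δ)` (`δ ∈ Gal(M/ℚ)`) of the two shadows `w_κ(z) = 2·#{t ∈ Φ_{i_κ} | t∘j_κ = z} − [K_{i_κ}:M]` span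
subspaces meeting in `0`.**  (Reduction to the pivot + the Hecke algebra of the torsor `Hom(M, ℂ)`: files S1–S3.)
[cite: Kubota1965, §2 Lemma 2 and §4] [cite: Gordon1999HodgeAVSurvey, §3 Theorem (proof), 7.5–7.7 and 9.4.3]
[cite: Lang2002, VI §1 Thm. 1.14] -/
theorem cmFamilyRank_add_card_eq_pair_iff_span_precomp_shadow_inf_eq_bot [IsGalois ℚ M] {i₀ i₁ : I} (h01 : i₀ ≠ i₁)
    (hI : ∀ l, l = i₀ ∨ l = i₁) (Φ : ∀ i, CMType (K i)) (j₀ : M →+* K i₀) (j₁ : M →+* K i₁) (z₀ : M →+* ℂ)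
    (hmeet : ∀ z : ℂ, z ∈ normalClosure ℚ (K i₀) ℂ → z ∈ normalClosure ℚ (K i₁) ℂ → z ∈ Set.range z₀) :
    CMAlgebra.cmFamilyRank Φ + Fintype.card I = (∑ i, cmTypeRank (Φ i)) + 1 ↔
      Submodule.span ℚ (Set.range fun δ : M ≃ₐ[ℚ] M => fun z : M →+* ℂ =>
          ∑ t ∈ Finset.univ.filter (fun t : K i₀ →+* ℂ => t.comp j₀ = z.comp (δ : M →+* M)),
            antiVec (Φ i₀).1 (1 : ℂ ≃+* ℂ) t) ⊓
        Submodule.span ℚ (Set.range fun δ : M ≃ₐ[ℚ] M => fun z : M →+* ℂ =>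
          ∑ t ∈ Finset.univ.filter (fun t : K i₁ →+* ℂ => t.comp j₁ = z.comp (δ : M →+* M)),
            antiVec (Φ i₁).1 (1 : ℂ ≃+* ℂ) t) = ⊥ := by
  haveI : Nonempty I := ⟨i₀⟩
  haveI : ∀ i, Nonempty (K i →+* ℂ) := fun i => inferInstance
  haveI := isPretransitive_ringEquiv_complex (K := M)
  exact IrrOdd.typeRank_sigmaType_add_card_eq_iff_span_precomp_inf_eq_bot (G := ℂ ≃+* ℂ) (E := fun i => K i →+* ℂ)
    (Φ := fun i => (Φ i).1) (fun i => isCMTypeWith_conj (Φ i)) hI h01 (fun t : K i₀ →+* ℂ => t.comp j₀)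
    (fun t : K i₁ →+* ℂ => t.comp j₁) (fun _ _ => RingHom.ext fun _ => rfl) (fun _ _ => RingHom.ext fun _ => rfl)
    (comp_surjective j₀) (comp_surjective j₁) {g : ℂ ≃+* ℂ | ∀ m : M, g (z₀ m) = z₀ m}
    (fun x x' hxx' => by
      obtain ⟨g, hg, hgx⟩ := exists_smul_eq_of_comp_eq j₀ z₀ hxx'.symm
      exact ⟨g, hg, hgx⟩)
    (fun x x' hxx' => by
      obtain ⟨g, hg, hgx⟩ := exists_smul_eq_of_comp_eq j₁ z₀ hxx'.symm
      exact ⟨g, hg, hgx⟩)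
    (fun g hg => mem_closure_fixing_of_normalClosure_inf_le z₀ hmeet hg)
    (fun (δ : M ≃ₐ[ℚ] M) (z : M →+* ℂ) => z.comp (δ : M →+* M)) (fun _ _ _ => RingHom.ext fun _ => rfl)
    comp_algEquiv_injective z₀ (exists_comp_algEquiv_eq z₀) (fun z => MulAction.exists_smul_eq (ℂ ≃+* ℂ) z z₀)

end Rank

/-! ### §3 Abelian pivots: the correlation criterion -/

section Abelian

variable {I : Type} [Fintype I] {K : I → Type} [∀ i, Field (K i)] [∀ i, NumberField (K i)] [∀ i, IsCMField (K i)]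
  {M : Type} [Field M] [NumberField M]

/-- **ONE NON-ZERO CORRELATION OF THE SHADOWS OBSTRUCTS `Hg(A₀ × A₁) = Hg(A₀) × Hg(A₁)`** (`M` ABELIAN Galois received
by both CM fields; no hypothesis on the Galois closures): if `Σ_z w₀(z)·w₁(z ∘ δ) ≠ 0` for some `δ ∈ Gal(M/ℚ)`, then
`cmFamilyRank Φ + |I| < Σ_i cmTypeRank Φ_i + 1`. [cite: Kubota1965, §2 Lemma 2] [cite: Gordon1999HodgeAVSurvey, 7.5 and 9.4.1] -/
theorem cmFamilyRank_add_card_lt_of_sum_shadow_mul_ne_zero [IsAbelianGalois ℚ M] {i₀ i₁ : I} (h01 : i₀ ≠ i₁)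
    (Φ : ∀ i, CMType (K i)) (j₀ : M →+* K i₀) (j₁ : M →+* K i₁) {δ : M ≃ₐ[ℚ] M}
    (hδ : ∑ z : M →+* ℂ, (∑ t ∈ Finset.univ.filter (fun t : K i₀ →+* ℂ => t.comp j₀ = z),
        antiVec (Φ i₀).1 (1 : ℂ ≃+* ℂ) t) *
      (∑ t ∈ Finset.univ.filter (fun t : K i₁ →+* ℂ => t.comp j₁ = z.comp (δ : M →+* M)),
        antiVec (Φ i₁).1 (1 : ℂ ≃+* ℂ) t) ≠ 0) :
    CMAlgebra.cmFamilyRank Φ + Fintype.card I < (∑ i, cmTypeRank (Φ i)) + 1 := by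
  haveI : Nonempty I := ⟨i₀⟩
  haveI : ∀ i, Nonempty (K i →+* ℂ) := fun i => inferInstance
  obtain ⟨z₀⟩ : Nonempty (M →+* ℂ) := inferInstance
  exact IrrOdd.typeRank_sigmaType_add_card_lt_of_sum_mul_precomp_ne_zero (G := ℂ ≃+* ℂ) (E := fun i => K i →+* ℂ)
    (Φ := fun i => (Φ i).1) (fun i => isCMTypeWith_conj (Φ i)) h01 (fun t : K i₀ →+* ℂ => t.comp j₀)
    (fun t : K i₁ →+* ℂ => t.comp j₁) (fun _ _ => RingHom.ext fun _ => rfl) (fun _ _ => RingHom.ext fun _ => rfl)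
    (fun (δ : M ≃ₐ[ℚ] M) (z : M →+* ℂ) => z.comp (δ : M →+* M)) (fun _ _ _ => RingHom.ext fun _ => rfl)
    (fun _ => RingHom.ext fun _ => rfl) (fun _ _ _ => RingHom.ext fun _ => rfl)
    (fun σ τ => IsMulCommutative.is_comm.comm σ τ) z₀ (exists_comp_algEquiv_eq z₀) hδ

/-- **THE CORRELATION CRITERION over an ABELIAN pivot.**  Two-slot family `{i₀, i₁}`; `M` ABELIAN Galois over `ℚ`,
`j_κ : M → K_{i_κ}`, `z₀ : M → ℂ`, Galois closures meeting inside `z₀(M)`.  Then `Hg(A₀ × A₁) = Hg(A₀) × Hg(A₁)`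
(`cmFamilyRank Φ + 2 = cmTypeRank Φ₀ + cmTypeRank Φ₁ + 1`) **iff the shadows are UNCORRELATED in every relative position:
`Σ_z w₀(z)·w₁(z ∘ δ) = 0` for every `δ ∈ Gal(M/ℚ)`** (`w_κ(z) = 2·#{t ∈ Φ_{i_κ} | t∘j_κ = z} − [K_{i_κ}:M]`).  `M = k`
imaginary quadratic: `±2·d₀d₁ = 0` (gen 62 O8); `Anti(M)` irreducible: O10.
[cite: Kubota1965, §2 Lemma 2] [cite: Gordon1999HodgeAVSurvey, §3 Theorem, 7.5–7.7 and 9.4.1–9.4.3] -/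
theorem cmFamilyRank_add_card_eq_pair_iff_forall_sum_shadow_mul_eq_zero [IsAbelianGalois ℚ M] {i₀ i₁ : I}
    (h01 : i₀ ≠ i₁) (hI : ∀ l, l = i₀ ∨ l = i₁) (Φ : ∀ i, CMType (K i)) (j₀ : M →+* K i₀) (j₁ : M →+* K i₁)
    (z₀ : M →+* ℂ)
    (hmeet : ∀ z : ℂ, z ∈ normalClosure ℚ (K i₀) ℂ → z ∈ normalClosure ℚ (K i₁) ℂ → z ∈ Set.range z₀) :
    CMAlgebra.cmFamilyRank Φ + Fintype.card I = (∑ i, cmTypeRank (Φ i)) + 1 ↔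
      ∀ δ : M ≃ₐ[ℚ] M, ∑ z : M →+* ℂ, (∑ t ∈ Finset.univ.filter (fun t : K i₀ →+* ℂ => t.comp j₀ = z),
          antiVec (Φ i₀).1 (1 : ℂ ≃+* ℂ) t) *
        (∑ t ∈ Finset.univ.filter (fun t : K i₁ →+* ℂ => t.comp j₁ = z.comp (δ : M →+* M)),
          antiVec (Φ i₁).1 (1 : ℂ ≃+* ℂ) t) = 0 := by
  haveI : Nonempty I := ⟨i₀⟩
  haveI : ∀ i, Nonempty (K i →+* ℂ) := fun i => inferInstance
  haveI := isPretransitive_ringEquiv_complex (K := M)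
  exact IrrOdd.typeRank_sigmaType_add_card_eq_iff_forall_sum_mul_precomp_eq_zero (G := ℂ ≃+* ℂ)
    (E := fun i => K i →+* ℂ) (Φ := fun i => (Φ i).1) (fun i => isCMTypeWith_conj (Φ i)) hI h01
    (fun t : K i₀ →+* ℂ => t.comp j₀) (fun t : K i₁ →+* ℂ => t.comp j₁) (fun _ _ => RingHom.ext fun _ => rfl)
    (fun _ _ => RingHom.ext fun _ => rfl) (comp_surjective j₀) (comp_surjective j₁)
    {g : ℂ ≃+* ℂ | ∀ m : M, g (z₀ m) = z₀ m}
    (fun x x' hxx' => by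
      obtain ⟨g, hg, hgx⟩ := exists_smul_eq_of_comp_eq j₀ z₀ hxx'.symm
      exact ⟨g, hg, hgx⟩)
    (fun x x' hxx' => by
      obtain ⟨g, hg, hgx⟩ := exists_smul_eq_of_comp_eq j₁ z₀ hxx'.symm
      exact ⟨g, hg, hgx⟩)
    (fun g hg => mem_closure_fixing_of_normalClosure_inf_le z₀ hmeet hg)
    (fun (δ : M ≃ₐ[ℚ] M) (z : M →+* ℂ) => z.comp (δ : M →+* M)) (fun _ _ _ => RingHom.ext fun _ => rfl)
    (fun _ => RingHom.ext fun _ => rfl) (fun _ _ _ => RingHom.ext fun _ => rfl)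
    (fun σ τ => IsMulCommutative.is_comm.comm σ τ) z₀ (exists_comp_algEquiv_eq z₀)
    (fun z => MulAction.exists_smul_eq (ℂ ≃+* ℂ) z z₀)

end Abelian

/-! ### §4 Realisations -/

section Hodge

variable {I : Type} [Fintype I] {K : I → Type} [∀ i, Field (K i)] [∀ i, NumberField (K i)] [∀ i, IsCMField (K i)]
  {M : Type} [Field M] [NumberField M]
  {Φ : ∀ i, CMType (K i)} {A : I → AbelianVariety ℂ} {ιA : ∀ i, 𝓞 (K i) →+* End (A i)}
  {θ : ∀ i, K i →+* Module.End ℂ (complexBetti (A i).X 1)}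

/-- **EVERY HODGE CLASS ON EVERY `A₀^a × A₁^b` IS A SUM OF PRODUCTS ⟺ THE HECKE MODULES OF THE SHADOWS MEET IN `0`**
(Galois pivot, closures meeting inside it; the left side quantifies over all biproducts with disjoint slot maps).
[cite: MoonenZarhin1999LowDim, §3 (3.1)] [cite: Gordon1999HodgeAVSurvey, 7.5–7.7 and 9.4.3] -/
theorem forall_hodgeClassesProductSpan_pair_iff_span_precomp_shadow_inf_eq_bot [IsGalois ℚ M] {i₀ i₁ : I}
    (h01 : i₀ ≠ i₁) (hI : ∀ l, l = i₀ ∨ l = i₁) (j₀ : M →+* K i₀) (j₁ : M →+* K i₁) (z₀ : M →+* ℂ)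
    (hmeet : ∀ z : ℂ, z ∈ normalClosure ℚ (K i₀) ℂ → z ∈ normalClosure ℚ (K i₁) ℂ → z ∈ Set.range z₀)
    (hA : ∀ i, IsCMTypeRealisation (Φ i) (A i) (ιA i) (θ i)) :
    (∀ (N₁ N₂ : ℕ) [NeZero N₁] [NeZero N₂] (π₁ : Fin N₁ → I) (π₂ : Fin N₂ → I), (∀ l₁ l₂, π₁ l₁ ≠ π₂ l₂) →
        HodgeClassesProductSpan (⨁ fun l => A (π₁ l)) (⨁ fun l => A (π₂ l))) ↔
      Submodule.span ℚ (Set.range fun δ : M ≃ₐ[ℚ] M => fun z : M →+* ℂ =>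
          ∑ t ∈ Finset.univ.filter (fun t : K i₀ →+* ℂ => t.comp j₀ = z.comp (δ : M →+* M)),
            antiVec (Φ i₀).1 (1 : ℂ ≃+* ℂ) t) ⊓
        Submodule.span ℚ (Set.range fun δ : M ≃ₐ[ℚ] M => fun z : M →+* ℂ =>
          ∑ t ∈ Finset.univ.filter (fun t : K i₁ →+* ℂ => t.comp j₁ = z.comp (δ : M →+* M)),
            antiVec (Φ i₁).1 (1 : ℂ ≃+* ℂ) t) = ⊥ := by
  haveI : Nonempty I := ⟨i₀⟩
  exact (cmFamilyRank_add_card_eq_iff_forall_hodgeClassesProductSpan hA).symm.trans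
    (cmFamilyRank_add_card_eq_pair_iff_span_precomp_shadow_inf_eq_bot h01 hI Φ j₀ j₁ z₀ hmeet)

/-- **… for an ABELIAN pivot: ⟺ the shadows are uncorrelated in every relative position.**
[cite: MoonenZarhin1999LowDim, §3 (3.1)] [cite: Kubota1965, §2 Lemma 2] [cite: Gordon1999HodgeAVSurvey, 7.5–7.7 and 9.4.1] -/
theorem forall_hodgeClassesProductSpan_pair_iff_forall_sum_shadow_mul_eq_zero [IsAbelianGalois ℚ M] {i₀ i₁ : I}
    (h01 : i₀ ≠ i₁) (hI : ∀ l, l = i₀ ∨ l = i₁) (j₀ : M →+* K i₀) (j₁ : M →+* K i₁) (z₀ : M →+* ℂ)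
    (hmeet : ∀ z : ℂ, z ∈ normalClosure ℚ (K i₀) ℂ → z ∈ normalClosure ℚ (K i₁) ℂ → z ∈ Set.range z₀)
    (hA : ∀ i, IsCMTypeRealisation (Φ i) (A i) (ιA i) (θ i)) :
    (∀ (N₁ N₂ : ℕ) [NeZero N₁] [NeZero N₂] (π₁ : Fin N₁ → I) (π₂ : Fin N₂ → I), (∀ l₁ l₂, π₁ l₁ ≠ π₂ l₂) →
        HodgeClassesProductSpan (⨁ fun l => A (π₁ l)) (⨁ fun l => A (π₂ l))) ↔
      ∀ δ : M ≃ₐ[ℚ] M, ∑ z : M →+* ℂ, (∑ t ∈ Finset.univ.filter (fun t : K i₀ →+* ℂ => t.comp j₀ = z),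
          antiVec (Φ i₀).1 (1 : ℂ ≃+* ℂ) t) *
        (∑ t ∈ Finset.univ.filter (fun t : K i₁ →+* ℂ => t.comp j₁ = z.comp (δ : M →+* M)),
          antiVec (Φ i₁).1 (1 : ℂ ≃+* ℂ) t) = 0 := by
  haveI : Nonempty I := ⟨i₀⟩
  exact (cmFamilyRank_add_card_eq_iff_forall_hodgeClassesProductSpan hA).symm.trans
    (cmFamilyRank_add_card_eq_pair_iff_forall_sum_shadow_mul_eq_zero h01 hI Φ j₀ j₁ z₀ hmeet)

/-- **A common non-zero Hecke combination of the shadows ⟹ a MIXED exceptional Hodge class** on some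
`(⨁_l A_{π₁ l}) × (⨁_l A_{π₂ l})` with disjoint slot maps (no hypothesis on the Galois closures).
[cite: MoonenZarhin1999LowDim, Thm. (0.1) (a)] [cite: Gordon1999HodgeAVSurvey, 7.5 and 9.4.3] -/
theorem exists_not_hodgeClassesProductSpan_pair_of_span_precomp_shadow_inf_ne_bot {i₀ i₁ : I} (h01 : i₀ ≠ i₁)
    (j₀ : M →+* K i₀) (j₁ : M →+* K i₁) (hA : ∀ i, IsCMTypeRealisation (Φ i) (A i) (ιA i) (θ i))
    (hne : Submodule.span ℚ (Set.range fun δ : M ≃ₐ[ℚ] M => fun z : M →+* ℂ =>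
        ∑ t ∈ Finset.univ.filter (fun t : K i₀ →+* ℂ => t.comp j₀ = z.comp (δ : M →+* M)),
          antiVec (Φ i₀).1 (1 : ℂ ≃+* ℂ) t) ⊓
      Submodule.span ℚ (Set.range fun δ : M ≃ₐ[ℚ] M => fun z : M →+* ℂ =>
        ∑ t ∈ Finset.univ.filter (fun t : K i₁ →+* ℂ => t.comp j₁ = z.comp (δ : M →+* M)),
          antiVec (Φ i₁).1 (1 : ℂ ≃+* ℂ) t) ≠ ⊥) :
    ∃ (N₁ N₂ : ℕ) (_ : NeZero N₁) (_ : NeZero N₂) (π₁ : Fin N₁ → I) (π₂ : Fin N₂ → I),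
      (∀ l₁ l₂, π₁ l₁ ≠ π₂ l₂) ∧ ¬ HodgeClassesProductSpan (⨁ fun l => A (π₁ l)) (⨁ fun l => A (π₂ l)) := by
  haveI : Nonempty I := ⟨i₀⟩
  exact exists_not_hodgeClassesProductSpan_of_cmFamilyRank_add_card_ne hA
    (ne_of_lt (cmFamilyRank_add_card_lt_of_span_precomp_shadow_inf_ne_bot h01 Φ j₀ j₁ hne))

/-- **One non-zero correlation of the shadows over an ABELIAN pivot ⟹ a MIXED exceptional Hodge class.**
[cite: MoonenZarhin1999LowDim, Thm. (0.1) (a)] [cite: Kubota1965, §2 Lemma 2] -/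
theorem exists_not_hodgeClassesProductSpan_pair_of_sum_shadow_mul_ne_zero [IsAbelianGalois ℚ M] {i₀ i₁ : I}
    (h01 : i₀ ≠ i₁) (j₀ : M →+* K i₀) (j₁ : M →+* K i₁) (hA : ∀ i, IsCMTypeRealisation (Φ i) (A i) (ιA i) (θ i))
    {δ : M ≃ₐ[ℚ] M}
    (hδ : ∑ z : M →+* ℂ, (∑ t ∈ Finset.univ.filter (fun t : K i₀ →+* ℂ => t.comp j₀ = z),
        antiVec (Φ i₀).1 (1 : ℂ ≃+* ℂ) t) *
      (∑ t ∈ Finset.univ.filter (fun t : K i₁ →+* ℂ => t.comp j₁ = z.comp (δ : M →+* M)),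
        antiVec (Φ i₁).1 (1 : ℂ ≃+* ℂ) t) ≠ 0) :
    ∃ (N₁ N₂ : ℕ) (_ : NeZero N₁) (_ : NeZero N₂) (π₁ : Fin N₁ → I) (π₂ : Fin N₂ → I),
      (∀ l₁ l₂, π₁ l₁ ≠ π₂ l₂) ∧ ¬ HodgeClassesProductSpan (⨁ fun l => A (π₁ l)) (⨁ fun l => A (π₂ l)) := by
  haveI : Nonempty I := ⟨i₀⟩
  exact exists_not_hodgeClassesProductSpan_of_cmFamilyRank_add_card_ne hA
    (ne_of_lt (cmFamilyRank_add_card_lt_of_sum_shadow_mul_ne_zero h01 Φ j₀ j₁ hδ))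

end Hodge

end Summit.HodgeConjecture.CorCM

end
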